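/-
COR-CM (cell pub-hodgecm2, stage 2 of the Hodge ladder) — count-neutral KERNEL COMBINATORICS «the octic product column G = Q₈ × B, D₄ × B: THE LAW μ = φ₂ (= β for Q₈ × B, = β − 2 for D₄ × B)»
(seat prover-pub-hodgecm2-b23-g45-0, binder prover b23, gen 45; own census lane OCTIC-PRODUCT, claim HOME/INBOX.md l.18829).  Theorems only — gen 44ʼs `Census/QuarticInversionLaw.lean` along an octic product datum, on `Census/OcticProduct{Transport,Stabiliser}` BY NAME; no `decide`, no certificate, no named fact, no `sorry`.
`Interfaces.lean` (C1), every E term, B01, `Transposition/*`, `PortJoin/*`, `D2Bridge/*` untouched.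
HONEST FRAMING: `HC_CM` is NOT proved, here or anywhere in the tree; nothing here is a period, a count of record or a headline.
T5: n/a-class (hypothesis binders = the datum equations / the slot data only); checker: self, 2026-08-24.
-/
import Summits.HodgeConjecture.CorCM.Census.OcticProductTransport
import Summits.HodgeConjecture.CorCM.Census.OcticProductStabiliser
import Summits.HodgeConjecture.CorCM.Census.ClockTypesLaw

/-!
# THE OCTIC PRODUCT LAW: `μ = φ₂` — `= β` for `Q₈ × B`, `= β − 2` for `D₄ × B` (central `B` of odd order, given a slot datum and a cross datum on `B`)

COR-CM (cell `pub-hodgecm2`, stage 2 of the Hodge ladder), count-neutral KERNEL COMBINATORICS by the binder seat b23 (gen 45; lane OCTIC-PRODUCT, HOME/INBOX.md l.18829 — the port of gen 44ʼs quartic inversion lane `Census/QuarticInversion*` to the datum with `y` CENTRAL on `ι(H₀)`).  Theorems only, on top of `Census/OcticProductTransport.lean` and the floors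
(`Census/OcticProductStabiliser.lean`; `|B|` odd ⇒ no element of order `4`, `Census/ClockTypesLaw.lean`), all BY NAME; no `decide`, no certificate, no named fact, no geometry, no `sorry`.  `Interfaces.lean`
(C1), every E term, B01, `Transposition/*`, `PortJoin/*` untouched.
HONEST FRAMING: `HC_CM` is NOT proved, here or anywhere in the tree; nothing here is a period, a count of record or a headline.

For a finite group `G` with a central involution `c` carrying an octic product datum `D : Datum G c B ζ` over a finite abelian group `B` of
odd order `≥ 3` (`G = H₀ ⊔ y H₀ ⊔ t H₀ ⊔ t y H₀`, `H₀ = ℤ/2 × B` CENTRAL, `y² = (ζ, 0)`, `t² = c`, `y t = c t y`; `ζ = 1`: `G ≅ Q₈ × B` with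
`c = (−1, 0)`, `ζ = 0`: `G ≅ D₄ × B` with `c = (r², 0)`), together with a
SLOT DATUM and a CROSS DATUM on `B` (`|P| + 1 = K`, `u₁ ≠ u₂ ∉ P`, `|Q| = K`, `w ∉ Q`, `s₀ ∈ P⁺`, `s + σ ∈ P⁺ ↔ s ∉ P⁺ ∨ s = s₀`,
`|B| = 2K + 1`; gen 44ʼs `Census/QuarticInversionCyclic.exists_slot_datum` provides them for `B = ℤ/(2K+1)`):
* §1 **EXISTENCE** (`exists_gfaces_generate`, both `ζ` at once): a finite set `S'` of abstract rank-four faces with `|S'| ≤ φ₂(G, c)`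
  (`= β(G, c) = #Block c` for `ζ = 1`, `= β − 2` for `ζ = 0`, `Census/OcticProductStabiliser.lean`) whose base changes, together with the pairs,
  span `hodgeSpan c` — transported from `Census/OcticProductGeneration.lean`.
* §2 **THE LAW** (`isLeast_card_gfaces_generate`, both `ζ` at once): with b09ʼs floor `φ₂ ≤ |S|` (`fibreTwo_mem_lowerBounds`) the least number
  of abstract rank-four faces whose base changes, together with the pairs, span `hodgeSpan c` is EXACTLY `φ₂(G, c)` — the coinvariant floor is
  ATTAINED in both columns; numerically `μ = β` for `ζ = 1` (`card_block_eq_fibreTwo_of_one`) and `μ = β − 2` for `ζ = 0`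
  (`card_block_eq_fibreTwo_add_two_of_zero`).
Census dictionary: for a Galois CM field whose group carries such a datum (degree `8|B|`; e.g. `Q₈ × ℤ/3`-fields of degree `24` with
`β = 172`, so EXACTLY `172` faces — lit-andre-3ʼs row `Census/TwentyFourC3Q8*`; `D₄ × ℤ/3`-fields with `c = (r², 0)`, `β = 184`, EXACTLY `182`) the Hodge ring of the whole slice is generated modulo
divisor classes by the Galois conjugates of exactly `β` resp. `β − 2` rank-four face classes, and no fewer Hodge generators exist modulo pairs.
`HC_CM` is NOT proved; nothing here is a period.  All [folklore].

## References
* [Pohlmann1968] H. Pohlmann, Algebraic cycles on abelian varieties of complex multiplication type, Ann. of Math. 88 (1968), Thm 1.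
* [Milne1999] J. S. Milne, Lefschetz motives and the Tate conjecture, Compositio Math. 117 (1999), Prop. 2.1, p. 54.
-/

namespace Summit.HodgeConjecture.CorCM.Census.OcticProduct

open Finset
open Summit.HodgeConjecture.CorCM.Prior.AllgGroup.RfwfAllgGroup
open Summit.HodgeConjecture.CorCM.Census.BlockParity
open Summit.HodgeConjecture.CorCM.Census.Coinvariant
open Summit.HodgeConjecture.CorCM.Census.OddSliceFacesModel



open Summit.HodgeConjecture.CorCM.Census.QuarticInversion (faceVec₄)

noncomputable section

variable {G : Type*} [Group G] [Fintype G] [DecidableEq G] {c : G}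
variable {A : Type} [AddCommGroup A] [Fintype A] [DecidableEq A] {ζ : ZMod 2}
variable (D : Datum G c A ζ)

/-! ## §1 Existence -/

include D in
/-- **EXISTENCE: `μ(G, c) ≤ φ₂(G, c)`** (both `ζ`; `|B|` odd `≥ 3` with a slot datum and a cross datum): the closing family has `≤ β` members
(`≤ β − 2` for `ζ = 0`), and `β = φ₂` (`ζ = 1`), `β = φ₂ + 2` (`ζ = 0`). [folklore] -/
theorem exists_gfaces_generate (hc2 : c * c = 1) (hA : Odd (Fintype.card A)) (h3 : 3 ≤ Fintype.card A)
    (hSlot : ∃ (P : Finset A) (u₁ u₂ : A) (Q : Finset A) (w σ s₀ : A), u₁ ∉ P ∧ u₂ ∉ P ∧ u₁ ≠ u₂ ∧ P.card + 1 = Fintype.card A / 2 ∧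
      s₀ ∈ insert u₁ (insert u₂ P) ∧ (∀ s, s + σ ∈ insert u₁ (insert u₂ P) ↔ (s ∉ insert u₁ (insert u₂ P) ∨ s = s₀)) ∧ w ∉ Q ∧
      Q.card = Fintype.card A / 2) :
    ∃ S' : Finset (CMF G c →₀ ℤ), ↑S' ⊆ gfaceSet G c hc2 ∧ S'.card ≤ fibreTwo c hc2 ∧
      hodgeSpan c hc2 ≤ Submodule.span ℤ (pairSet c) ⊔ Submodule.span ℤ (translates c S') := by
  obtain ⟨P, u₁, u₂, Q, w, σ, s₀, h1, h2, h12, hP, hs₀, hX, hw, hQ⟩ := hSlot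
  have hshape : ∀ f ∈ genFamily A ζ P u₁ u₂ Q w 0, ∃ Θ p q, p ≠ q ∧ f = faceVec₄ A Θ p q := fun f hf => genFamily_shape A ζ h12 hf
  refine ⟨(genFamily A ζ P u₁ u₂ Q w 0).image (gfOf D hc2), image_gfOf_subset_gfaceSet D hc2 hshape, ?_,
    hodgeSpan_le_of_family D hc2 hshape (hodge₄_le A ζ hA h3 h1 h2 h12 hP hs₀ hX hw hQ)⟩
  refine Finset.card_image_le.trans ?_
  have hβ := card_block_eq D
  have h01 : ∀ z : ZMod 2, z = 0 ∨ z = 1 := by decide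
  rcases h01 ζ with rfl | rfl
  · have h := card_genFamily_add_two_le A (P := P) (u₁ := u₁) (u₂ := u₂) (Q := Q) (w := w) (u₀ := 0) hA (by omega)
    have hφ := card_block_eq_fibreTwo_add_two_of_zero D hc2
    omega
  · have h := card_genFamily_le A 1 (P := P) (u₁ := u₁) (u₂ := u₂) (Q := Q) (w := w) (u₀ := 0) hA (by omega)
    have hφ := card_block_eq_fibreTwo_of_one D (ClockTypes.not_four_dvd_addOrderOf_of_odd hA) hc2
    omega

/-! ## §2 The law -/

include D in
/-- **THE OCTIC PRODUCT LAW `μ(G, c) = φ₂(G, c)`** for `(G, c)` carrying an octic product datum of either square class `ζ` (`ζ = 1`: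
`G ≅ Q₈ × B`, `c = (−1, 0)`, `φ₂ = β`; `ζ = 0`: `G ≅ D₄ × B`, `c = (r², 0)`, `φ₂ = β − 2`) over `B` of odd order `≥ 3` with a slot datum and a
cross datum: the coinvariant floor is attained. [folklore] -/
theorem isLeast_card_gfaces_generate (hc2 : c * c = 1) (hA : Odd (Fintype.card A)) (h3 : 3 ≤ Fintype.card A)
    (hSlot : ∃ (P : Finset A) (u₁ u₂ : A) (Q : Finset A) (w σ s₀ : A), u₁ ∉ P ∧ u₂ ∉ P ∧ u₁ ≠ u₂ ∧ P.card + 1 = Fintype.card A / 2 ∧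
      s₀ ∈ insert u₁ (insert u₂ P) ∧ (∀ s, s + σ ∈ insert u₁ (insert u₂ P) ↔ (s ∉ insert u₁ (insert u₂ P) ∨ s = s₀)) ∧ w ∉ Q ∧
      Q.card = Fintype.card A / 2) :
    IsLeast {m : ℕ | ∃ S : Finset (CMF G c →₀ ℤ), ↑S ⊆ gfaceSet G c hc2 ∧ S.card = m ∧
      hodgeSpan c hc2 ≤ Submodule.span ℤ (pairSet c) ⊔ Submodule.span ℤ (translates c S)} (fibreTwo c hc2) := by
  have hfloor := fibreTwo_mem_lowerBounds hc2 (mul_c_comm D)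
  refine ⟨?_, hfloor⟩
  obtain ⟨S, hS, hcard, hgen⟩ := exists_gfaces_generate D hc2 hA h3 hSlot
  have h := hfloor ⟨S, hS, rfl, hgen⟩
  exact ⟨S, hS, by omega, hgen⟩

end

end Summit.HodgeConjecture.CorCM.Census.OcticProduct
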